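import Literature.AnabelianGeometry.EtaleTheta.Discharge.Sec5EnvelopeTopology

/-!
# [EtTh] §5 merge adapter (MERGE-PLAN §2a, Π-block): §5 data whose tempered groups ARE those of a §2 `ThetaEnvData` (pp. 330–332 / PDF pp. 104–106)

Mochizuki, *The étale theta function …*, Publ. RIMS **45** (2009)
[cite: MochizukiEtTh2009, Lem 5.9 (iv) p.332 (PDF p.106)].  Seat abc-iut-L2-t4 (§5 owner), MERGE-PLAN §2a
(HOME/staging/L2/L2-t4/MERGE-PLAN.md).  ADDITIVE: a CONSTRUCTOR for abc-iut-L2-t4's `ThetaFrobenioid` (FrobenioidTheta.lean,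
FROZEN) and theorems about its values; nothing landed is edited.

The §5 data `ThetaFrobenioid C D` carry the tempered groups `Π^tp_X̲ ⊇ Π^tp_Y̲ ⊇ Π^tp_Ÿ̲` (Lemma 5.9, Theorem 5.10) as their own
fields `PiX, zquot, PiYdd, …` (`TODO-merge(abc-iut-L2-t2 / abc-iut-L3-t2)`), and the comparison statements of Lemma 5.9 (iv)
/ Theorem 5.10 (iii) with abc-iut-L2-t2's §2 interface `ThetaEnvData N` (`MonoThetaEnv.lean`) therefore run through an
identification `ι : Π^tp_X̲ ≃ T.PiX` and the dictionary hypotheses `IdentifiesPiY T ι`, `IdentifiesPiYdd T ι`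
(`FrobenioidEnvelopeIso.lean`, `Discharge/Sec5EnvelopeTopology.lean`).  Print has ONE set of groups.  This file provides
`ThetaFrobenioid.ofThetaEnvData T …`: the §5 data whose Π-block IS `T`'s — `Π^tp_X̲ := T.PiX`, `Π^tp_X̲ ↠ l·ℤ := `
`T.galYX ∘ (T.PiX ↠ T.PiX/T.PiY)` ("`Gal(Y/X) (≅ l·ℤ)`", Def. 2.13 (i), p.273 (PDF p.47); "`l·ℤ ⥲ Π^tp_X/Π^tp_Y`", Lemma 5.9
(iii), p.332 (PDF p.106)), `Π^tp_Ÿ̲ := T.PiYdd` with `[Π^tp_Y̲ : Π^tp_Ÿ̲] = 2` from `T.index_PiYdd` — all remaining §5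
fields (the Frobenioid side, `ρ`, the sections, the constants, `Θ̈`) being supplied by the caller; and PROVES that for such
data `ι := id` identifies `Π^tp_Y̲`, `Π^tp_Ÿ̲` on the nose (`identifiesPiY_ofThetaEnvData`, `identifiesPiYdd_ofThetaEnvData`),
i.e. two of the dictionary hypotheses of Lemma 5.9 (iv)'s discharge (abc-iut-L2-t11 `envIsoBiTheta_of`) DISAPPEAR for §5 data
built over the §2 data (e.g. abc-iut-L2-t8's genuine `EtaleThetaData.DoubleUnderline.thetaEnvData` of a Tate curve).
HONEST FRAMING: a constructor and bookkeeping lemmas; nothing of [EtTh] is asserted; no side is taken on anything downstream.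
-/

namespace Literature.AnabelianGeometry.EtaleTheta

open CategoryTheory

universe w v v' u u'

namespace ThetaEnvData

variable {N : ℕ+} (T : ThetaEnvData.{v} N)


/-- `Π^tp_X ↠ Π^tp_X/Π^tp_Y ⥲ ℤ` ("`Gal(Y/X) (≅ l·ℤ)`", Def. 2.13 (i), p.273 (PDF p.47)), the surjection whose kernel is `Π^tp_Y` —
the shape in which abc-iut-L2-t4's §5 data carry "`l·ℤ ⥲ Π^tp_X/Π^tp_Y`" (Lemma 5.9 (iii), p.332 (PDF p.106)).
[cite: MochizukiEtTh2009, Def 2.13 (i) p.273 (PDF p.47); Lem 5.9 (iii) p.332 (PDF p.106)] -/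
noncomputable def zquot : T.PiX →* Multiplicative ℤ :=
  haveI := T.PiY_normal
  T.galYX.toMonoidHom.comp (QuotientGroup.mk' T.PiY)

/-- `Ker(Π^tp_X ↠ ℤ) = Π^tp_Y`. [cite: MochizukiEtTh2009, Def 2.13 (i) p.273 (PDF p.47)] -/
theorem ker_zquot : T.zquot.ker = T.PiY := by
  haveI := T.PiY_normal
  ext x
  rw [MonoidHom.mem_ker, zquot, MonoidHom.comp_apply, MulEquiv.coe_toMonoidHom,
    MulEquiv.map_eq_one_iff, QuotientGroup.mk'_apply, QuotientGroup.eq_one_iff]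

/-- `Π^tp_X ↠ ℤ` is onto. [cite: MochizukiEtTh2009, Def 2.13 (i) p.273 (PDF p.47)] -/
theorem zquot_surjective : Function.Surjective T.zquot := by
  haveI := T.PiY_normal
  exact T.galYX.surjective.comp (QuotientGroup.mk'_surjective T.PiY)

end ThetaEnvData

namespace ThetaFrobenioid

variable {C : Type u} [Category.{v} C] {D : Type u'} [Category.{v'} D]

/-- **§5 data over a §2 `ThetaEnvData`** (MERGE-PLAN §2a, Π-block): the `ThetaFrobenioid C D` whose tempered groups are
`T`'s — `Π^tp_X̲ := T.PiX` (p.330 (PDF p.104)), `Π^tp_X̲ ↠ l·ℤ := T.zquot` (Lemma 5.9 (iii), p.332 (PDF p.106)),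
`Π^tp_Ÿ̲ := T.PiYdd` with `Π^tp_Ÿ̲ ⊆ Π^tp_Y̲ = Ker`, `[Π^tp_Y̲ : Π^tp_Ÿ̲] = 2`, normal, open (all from `T`'s fields) — and all
other fields (the tempered-Frobenioid stub, the subquotient stub, `l`, `A_⊚, A_N, B_N, s^⊓_N, s^⊔_N`, the Galois action `ρ` on
`B_N^bs`, `s^trv_N, s^⊓-gp_N, s^⊔-gp_N`, the constants and `Θ̈`) as given.
[cite: MochizukiEtTh2009, §5 p.330–332 (PDF pp.104–106)] -/
noncomputable def ofThetaEnvData (F : FrobenioidTheta.TemperedFrobenioidStub.{w} C D)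
    (Q : FrobenioidTheta.ThetaSubquotientStub.{w} D) (l : ℕ) (odd_l : Odd l) (N : ℕ+) (T : ThetaEnvData.{v} N)
    (Acirc AN BN : C) (sCap sCup : AN ⟶ BN) (base_map_sCap : F.pre.base.map sCap = F.pre.base.map sCup)
    (isPreStep_sCap : F.pre.IsPreStep sCap) (isPreStep_sCup : F.pre.IsPreStep sCup)
    (ρ : T.PiX →* Aut (F.pre.base.obj BN)) (ρ_surjective : Function.Surjective ρ)
    (isOpen_ker_ρ : IsOpen (ρ.ker : Set T.PiX)) (strv : Aut (F.pre.base.obj AN) →* Aut AN)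
    (sgpCap : Aut (F.pre.base.obj BN) →* Aut BN) (sgpCup : T.PiYdd.map ρ →* Aut BN)
    (K : Type w) [Field K] (constEmb : Kˣ →* F.biratUnits BN) (constEmb_injective : Function.Injective constEmb)
    (thetaFn : F.biratUnits Acirc) : ThetaFrobenioid.{w} C D where
  toTemperedFrobenioidStub := F
  toThetaSubquotientStub := Q
  l := l
  odd_l := odd_l
  N := N
  Acirc := Acirc
  AN := AN
  BN := BN
  sCap := sCap
  sCup := sCup
  base_map_sCap := base_map_sCap
  isPreStep_sCap := isPreStep_sCap
  isPreStep_sCup := isPreStep_sCup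
  PiX := T.PiX
  zquot := T.zquot
  zquot_surjective := T.zquot_surjective
  PiYdd := T.PiYdd
  PiYdd_le := T.ker_zquot.symm ▸ T.PiYdd_le
  relindex_PiYdd := by rw [T.ker_zquot]; exact T.index_PiYdd
  PiYdd_normal := T.PiYdd_normal
  isOpen_PiYdd := T.PiYdd_open
  ρ := ρ
  ρ_surjective := ρ_surjective
  isOpen_ker_ρ := isOpen_ker_ρ
  strv := strv
  sgpCap := sgpCap
  sgpCup := sgpCup
  K := K
  constEmb := constEmb
  constEmb_injective := constEmb_injective
  thetaFn := thetaFn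

section

variable (F : FrobenioidTheta.TemperedFrobenioidStub.{w} C D) (Q : FrobenioidTheta.ThetaSubquotientStub.{w} D)
  (l : ℕ) (odd_l : Odd l) (N : ℕ+) (T : ThetaEnvData.{v} N) (Acirc AN BN : C) (sCap sCup : AN ⟶ BN)
  (base_map_sCap : F.pre.base.map sCap = F.pre.base.map sCup)
  (isPreStep_sCap : F.pre.IsPreStep sCap) (isPreStep_sCup : F.pre.IsPreStep sCup)
  (ρ : T.PiX →* Aut (F.pre.base.obj BN)) (ρ_surjective : Function.Surjective ρ)
  (isOpen_ker_ρ : IsOpen (ρ.ker : Set T.PiX)) (strv : Aut (F.pre.base.obj AN) →* Aut AN)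
  (sgpCap : Aut (F.pre.base.obj BN) →* Aut BN) (sgpCup : T.PiYdd.map ρ →* Aut BN)
  (K : Type w) [Field K] (constEmb : Kˣ →* F.biratUnits BN) (constEmb_injective : Function.Injective constEmb)
  (thetaFn : F.biratUnits Acirc)

/-- The level of the data is `N` (so `T : ThetaEnvData 𝔉.N` definitionally). [cite: MochizukiEtTh2009, §5 p.323 (PDF p.97)] -/
theorem ofThetaEnvData_N : (ofThetaEnvData F Q l odd_l N T Acirc AN BN sCap sCup base_map_sCap isPreStep_sCap
      isPreStep_sCup ρ ρ_surjective isOpen_ker_ρ strv sgpCap sgpCup K constEmb constEmb_injective thetaFn).N = N := rfl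

/-- `Π^tp_X̲` of the data IS `T.PiX`. [cite: MochizukiEtTh2009, §5 p.330 (PDF p.104)] -/
theorem ofThetaEnvData_PiX : (ofThetaEnvData F Q l odd_l N T Acirc AN BN sCap sCup base_map_sCap isPreStep_sCap
      isPreStep_sCup ρ ρ_surjective isOpen_ker_ρ strv sgpCap sgpCup K constEmb constEmb_injective thetaFn).PiX = T.PiX := rfl

/-- `Π^tp_Y̲` of the data IS `T.PiY` (`Ker(Π^tp_X ↠ ℤ) = Π^tp_Y`). [cite: MochizukiEtTh2009, Lem 5.9 (iii) p.332 (PDF p.106)] -/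
theorem ofThetaEnvData_PiY : (ofThetaEnvData F Q l odd_l N T Acirc AN BN sCap sCup base_map_sCap isPreStep_sCap
      isPreStep_sCup ρ ρ_surjective isOpen_ker_ρ strv sgpCap sgpCup K constEmb constEmb_injective thetaFn).PiY = T.PiY := T.ker_zquot

/-- `Π^tp_Ÿ̲` of the data IS `T.PiYdd`. [cite: MochizukiEtTh2009, Lem 5.9 (iv) p.332 (PDF p.106)] -/
theorem ofThetaEnvData_PiYdd : (ofThetaEnvData F Q l odd_l N T Acirc AN BN sCap sCup base_map_sCap isPreStep_sCap
      isPreStep_sCup ρ ρ_surjective isOpen_ker_ρ strv sgpCap sgpCup K constEmb constEmb_injective thetaFn).PiYdd = T.PiYdd := rfl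

/-- **The dictionary hypothesis `IdentifiesPiY` DISAPPEARS**: for §5 data built over `T`, the identity identification carries
`Π^tp_Y̲` onto `Π^tp_Y` on the nose.  [cite: MochizukiEtTh2009, Lem 5.9 (iv) p.332 (PDF p.106)] -/
theorem identifiesPiY_ofThetaEnvData : (ofThetaEnvData F Q l odd_l N T Acirc AN BN sCap sCup base_map_sCap isPreStep_sCap
      isPreStep_sCup ρ ρ_surjective isOpen_ker_ρ strv sgpCap sgpCup K constEmb constEmb_injective thetaFn).IdentifiesPiY T (MulEquiv.refl T.PiX) := by
  intro y
  rw [ofThetaEnvData_PiY]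
  rfl

/-- **The dictionary hypothesis `IdentifiesPiYdd` DISAPPEARS** likewise.  [cite: MochizukiEtTh2009, Lem 5.9 (iv) p.332 (PDF p.106)] -/
theorem identifiesPiYdd_ofThetaEnvData : (ofThetaEnvData F Q l odd_l N T Acirc AN BN sCap sCup base_map_sCap isPreStep_sCap
      isPreStep_sCup ρ ρ_surjective isOpen_ker_ρ strv sgpCap sgpCup K constEmb constEmb_injective thetaFn).IdentifiesPiYdd T (MulEquiv.refl T.PiX) :=
  fun _ => Iff.rfl

end

end ThetaFrobenioid

end Literature.AnabelianGeometry.EtaleTheta
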